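import Summits.QuantumFields.YangMills.Theorems.BalabanUVNodesN14LawChannelTunedEndToEnd
import Summits.QuantumFields.YangMills.Theorems.BalabanUVNodesN14LawChannelTunedPathToy

/-!
# DAG node N14 (NE1′) — LENS control CARD 11 END TO END: a DECIDED ONE-SPIN TOWER inhabiting `cauchySeq_genFun_of_tunedData` with NON-TRIVIAL,
# SUMMABLE defects (the lineage's A2 index `INHABITANTS.md`, last open row, closed)

Cell `pub-ymgap`, seat `pub-ymgap-dag-n14-c` (R134 (a) N14 NE1′ s1), generation 9; `--kind proof --supports` the K3 item of the day `--as helper` (helper, NOT a discharge).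
Imports this lineage's `…N14LawChannelTunedEndToEnd` (p525061: ★★ `cauchySeq_genFun_of_tunedData`) and `…N14LawChannelTunedPathToy` (p539150: the one-spin letters
`integral_uniform_bool`, `isProbabilityMeasure_uniform_bool`, `integral_spin_tilted`, `cov_spin_tilted`, `inv_cosh_sq_le_cov_spin`).

WHY.  `cauchySeq_genFun_of_tunedData` (CARD 11 composed: response + detuning + conditioned-oscillation budget per cutoff, summable ⇒ Cauchy generating functions) carries
twenty binders; its only exhibited inhabitant so far was the defect-free tower (`D_K ≡ 0`, HOME `INHABITANTS.md`).  This file DISCHARGES ALL TWENTY on a decided tower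
with `D_K ≠ 0` at every cutoff: one spin `σ = ±1`, cutoff-`K` law `μ_K = uniform.tilted(a_K·σ)` with accumulated tilt `a_K = Σ_{j<K} c_j`, defects `D_K = c_K·σ`,
`c_K = (c₀∕2)·2^{−K}` (`0 < c₀ ≤ 1∕100`), projections `π_K = id` (so `μ_{K+1} = μ_K.tilted D_K` EXACTLY — Mathlib `tilted_tilted`), `F_K = R_K = S_K = σ`, trivial
unit-field σ-algebra `m_K = ⊤` (one class — the conditioned defect is the defect), window `l₀ = V = ½`, `vol = B₀ = 1`, response floor `γ₀ = (cosh 5∕4)⁻²`, budget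
`b_K = 2·c_K·(1 + 3∕γ₀)` (summable, geometric).
* §1 [folklore] one-variable letters: `hasDerivAt_tanh'`, private `abs_tanh_sub_tanh_le` (tanh is 1-Lipschitz; the tree has the same statement in a Ventures
  solver file — kept private here rather than importing across summits), private `exp_two_lt_nine'` (idem, QCD), `gamma0_window` (`1∕100 ≤ γ₀·½`).
* §2 [folklore] the tower's laws: `tilted_spin_add` (`(U.tilted(a·σ)).tilted g = U.tilted(a·σ + g)`), `accum_nonneg` ∕ `accum_le` (`0 ≤ a_K ≤ c₀`), `accum_succ`,
  `isProbabilityMeasure_spinLaw`, `map_id_spinLaw_succ` (the push-forward identity `hpush`).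
* §3 [folklore] the per-cutoff data: `toyTower_response` (γ₀ ≤ Cov on the strip), `toyTower_chordMean` ∕ `toyTower_endpoints` (`r₀ = tanh(a+s)`, `r₁ = tanh(a+s+e)`),
  `toyTower_detuning` (≤ 2c_K), `toyTower_osc` (the conditioned-oscillation budget `≤ 2(c_K + |w|)`; `m = ⊤` so `μ̂[g|m] = g`).
* §4 ★ `tunedTower_cauchy_of_letters` (the package APPLIED at letters `a, c`: every binder supplied), ★★ `toy_tunedTower_cauchy` (`CauchySeq (K ↦ genFun Z K t)` for
  `|t| ≤ ½`, `Z K t = mgf σ μ_K t`), ★ `toy_tunedTower_nondegenerate` (`D_K ≠ 0` and the mean shift `r₁(K) ≠ r₀(K)` at every `K`).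

HONEST FRAMING.  A decided toy closing an A2 row; ONE CLASS (no fibre: `m = ⊤`), so it says nothing about the law channel's conditioning gain — only that the composed
package is jointly satisfiable with genuine, summable defects; [folklore]; nothing of Bałaban's; N14 NOT discharged; count-neutral; 0 `def`, 0 `sorry`.
One finite T⁴ programme at fixed ε — NOT continuum ∕ ℝ⁴ ∕ OS ∕ mass gap ∕ Clay.
-/

noncomputable section

namespace YMDAG.N14.LawChannelTunedEndToEndToy

open MeasureTheory ProbabilityTheory Set Filter Topology Finset
open scoped ENNReal
open Literature.MathematicalPhysics.QuantumFieldTheory.Balaban1983to89.T4CauchySum (genFun)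
open YMDAG.N14.LawChannelTunedEndToEnd (cauchySeq_genFun_of_tunedData)
open YMDAG.N14.LawChannelTunedPathToy (integral_uniform_bool isProbabilityMeasure_uniform_bool integral_spin_tilted cov_spin_tilted
  inv_cosh_sq_le_cov_spin)

/-! ## §1 One-variable letters -/
section Letters

/-- `tanh′ = (cosh)⁻²` (from `sinh′ = cosh`, `cosh′ = sinh`, `cosh² − sinh² = 1`). [folklore] -/
theorem hasDerivAt_tanh' (x : ℝ) : HasDerivAt Real.tanh ((Real.cosh x ^ 2)⁻¹) x := by
  have hc : Real.cosh x ≠ 0 := (Real.cosh_pos x).ne'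
  have h := (Real.hasDerivAt_sinh x).div (Real.hasDerivAt_cosh x) hc
  have e : Real.tanh = fun y => Real.sinh y / Real.cosh y := funext Real.tanh_eq_sinh_div_cosh
  rw [e]
  refine h.congr_deriv ?_
  have h2 := Real.cosh_sq_sub_sinh_sq x
  field_simp
  nlinarith [h2]

/-- **tanh is 1-Lipschitz**: `|tanh x − tanh y| ≤ |x − y|` (`0 ≤ 1 − tanh² ≤ 1` and the mean-value inequality). [folklore] -/
private theorem abs_tanh_sub_tanh_le (x y : ℝ) : |Real.tanh x - Real.tanh y| ≤ |x - y| := by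
  have key : ∀ a b : ℝ, a ≤ b → |Real.tanh b - Real.tanh a| ≤ b - a := by
    intro a b hab
    have hbound : ∀ z ∈ Ico a b, ‖(Real.cosh z ^ 2)⁻¹‖ ≤ 1 := fun z _ => by
      rw [Real.norm_eq_abs, abs_of_nonneg (by positivity)]
      exact inv_le_one_of_one_le₀ (one_le_pow₀ (Real.one_le_cosh z))
    have h := norm_image_sub_le_of_norm_deriv_le_segment' (f := Real.tanh) (fun z _ => (hasDerivAt_tanh' z).hasDerivWithinAt) hbound
      b (right_mem_Icc.2 hab)
    rwa [Real.norm_eq_abs, one_mul] at h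
  rcases le_total y x with h | h
  · rw [abs_of_nonneg (sub_nonneg.2 h)]; exact key y x h
  · rw [abs_sub_comm (Real.tanh x), abs_sub_comm x y, abs_of_nonneg (sub_nonneg.2 h)]; exact key x y h

/-- `e² < 9`. [folklore] -/
private theorem exp_two_lt_nine' : Real.exp 2 < 9 := by
  have h1 := Real.exp_one_lt_d9
  have h0 : 0 < Real.exp 1 := Real.exp_pos 1
  rw [show (2 : ℝ) = 1 + 1 by norm_num, Real.exp_add]
  nlinarith

/-- **THE WINDOW REACHES**: `1∕100 ≤ (cosh 5∕4)⁻²·½` (`cosh x ≤ e^{x²∕2}`, `(5∕4)²∕2 ≤ 1`, `e² < 9`). [folklore] -/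
theorem gamma0_window : (1 : ℝ) / 100 ≤ (Real.cosh (5 / 4) ^ 2)⁻¹ * (1 / 2) := by
  have hcosh : Real.cosh (5 / 4) ≤ Real.exp ((5 / 4 : ℝ) ^ 2 / 2) := Real.cosh_le_exp_half_sq _
  have h1 : Real.exp ((5 / 4 : ℝ) ^ 2 / 2) ≤ Real.exp 1 := Real.exp_le_exp.2 (by norm_num)
  have hpos : 0 < Real.cosh (5 / 4) := Real.cosh_pos _
  have hsq : Real.cosh (5 / 4) ^ 2 ≤ Real.exp 2 := by
    calc Real.cosh (5 / 4) ^ 2 ≤ Real.exp 1 ^ 2 := pow_le_pow_left₀ hpos.le (hcosh.trans h1) 2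
      _ = Real.exp 2 := by rw [← Real.exp_nat_mul]; norm_num
  have h9 : Real.cosh (5 / 4) ^ 2 < 9 := lt_of_le_of_lt hsq exp_two_lt_nine'
  have hinv : (9 : ℝ)⁻¹ ≤ (Real.cosh (5 / 4) ^ 2)⁻¹ := inv_anti₀ (by positivity) h9.le
  nlinarith

end Letters

/-! ## §2 The tower's laws on the one-spin space -/
section Laws

/-- Tilting the tilted one-spin law: `(U.tilted(a·σ)).tilted g = U.tilted(a·σ + g)` (Mathlib `tilted_tilted`; everything is integrable on `Bool`). [folklore] -/
theorem tilted_spin_add (a : ℝ) (g : Bool → ℝ) :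
    (((2 : ℝ≥0∞)⁻¹ • (Measure.count : Measure Bool)).tilted fun b => a * (if b then (1 : ℝ) else -1)).tilted g =
      ((2 : ℝ≥0∞)⁻¹ • (Measure.count : Measure Bool)).tilted fun b => a * (if b then (1 : ℝ) else -1) + g b := by
  haveI := isProbabilityMeasure_uniform_bool
  rw [tilted_tilted Integrable.of_finite g]
  rfl

/-- The cutoff-`K` law is a probability measure. [folklore] -/
theorem isProbabilityMeasure_spinLaw (a : ℝ) :
    IsProbabilityMeasure (((2 : ℝ≥0∞)⁻¹ • (Measure.count : Measure Bool)).tilted fun b => a * (if b then (1 : ℝ) else -1)) :=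
  haveI := isProbabilityMeasure_uniform_bool
  isProbabilityMeasure_tilted Integrable.of_finite

/-- The accumulated tilt `a_K = (c₀∕2)·Σ_{j<K} 2^{−j}` is nonnegative. [folklore] -/
theorem accum_nonneg {c₀ : ℝ} (hc₀ : 0 ≤ c₀) (K : ℕ) : 0 ≤ c₀ / 2 * ∑ j ∈ range K, (1 / 2 : ℝ) ^ j :=
  mul_nonneg (by linarith) (sum_nonneg fun j _ => by positivity)

/-- … and at most `c₀` (`Σ_{j<K} 2^{−j} ≤ 2`). [folklore] -/
theorem accum_le {c₀ : ℝ} (hc₀ : 0 ≤ c₀) (K : ℕ) : c₀ / 2 * ∑ j ∈ range K, (1 / 2 : ℝ) ^ j ≤ c₀ := by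
  have := sum_geometric_two_le K
  nlinarith

/-- One more cutoff adds the defect size: `a_{K+1} = a_K + c_K`. [folklore] -/
theorem accum_succ (c₀ : ℝ) (K : ℕ) :
    c₀ / 2 * ∑ j ∈ range (K + 1), (1 / 2 : ℝ) ^ j = c₀ / 2 * ∑ j ∈ range K, (1 / 2 : ℝ) ^ j + c₀ / 2 * (1 / 2 : ℝ) ^ K := by
  rw [sum_range_succ, mul_add]

/-- **THE PUSH-FORWARD IDENTITY `hpush`**: with `π_K = id` and `a′ = a + e`, `U.tilted(a′·σ) = (U.tilted(a·σ)).tilted(e·σ)` EXACTLY (`tilted_tilted`). [folklore] -/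
theorem map_id_spinLaw_succ {a a' e : ℝ} (h : a' = a + e) :
    (((2 : ℝ≥0∞)⁻¹ • (Measure.count : Measure Bool)).tilted fun b => a' * (if b then (1 : ℝ) else -1)).map id =
      (((2 : ℝ≥0∞)⁻¹ • (Measure.count : Measure Bool)).tilted fun b => a * (if b then (1 : ℝ) else -1)).tilted
        fun b => e * (if b then (1 : ℝ) else -1) := by
  rw [Measure.map_id, tilted_spin_add]
  congr 1
  funext b
  rw [h]
  ring

end Laws

/-! ## §3 The per-cutoff data: response, detuning, endpoint gap, conditioned oscillation -/
section Data

/-- **RESPONSE** on the strip: with accumulated tilt `|a| ≤ c₀ ≤ 1∕100`, source `|s| ≤ ½`, defect size `0 ≤ e ≤ c₀`, `u ∈ [0,1]`, `|v| ≤ ½`, the tilted one-spin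
covariance is `≥ γ₀ = (cosh 5∕4)⁻²`. [folklore] -/
theorem toyTower_response {c₀ a s e u v : ℝ} (hc₀ : c₀ ≤ 1 / 100) (ha : |a| ≤ c₀) (hs : |s| ≤ 1 / 2) (he0 : 0 ≤ e) (he : e ≤ c₀)
    (hu : u ∈ Icc (0 : ℝ) 1) (hv : v ∈ Icc (-(1 / 2 : ℝ)) (1 / 2)) :
    (Real.cosh (5 / 4) ^ 2)⁻¹ ≤ cov[(fun b : Bool => if b then (1 : ℝ) else -1), (fun b : Bool => if b then (1 : ℝ) else -1);
      (((2 : ℝ≥0∞)⁻¹ • (Measure.count : Measure Bool)).tilted fun b => a * (if b then (1 : ℝ) else -1)).tilted fun b =>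
        s * (if b then (1 : ℝ) else -1) + u * (e * (if b then (1 : ℝ) else -1)) + v * (if b then (1 : ℝ) else -1)] := by
  rw [tilted_spin_add]
  have eq : (fun b : Bool => a * (if b then (1 : ℝ) else -1) +
      (s * (if b then (1 : ℝ) else -1) + u * (e * (if b then (1 : ℝ) else -1)) + v * (if b then (1 : ℝ) else -1))) =
      fun b => (a + s + u * e + v) * (if b then (1 : ℝ) else -1) := by funext b; ring
  rw [eq]
  refine inv_cosh_sq_le_cov_spin (abs_le.2 ⟨?_, ?_⟩)
  · have := (abs_le.1 ha).1; have := (abs_le.1 hs).1; nlinarith [hu.1, hv.1, hu.2]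
  · have := (abs_le.1 ha).2; have := (abs_le.1 hs).2; nlinarith [hu.1, hv.2, hu.2]

/-- The straight-chord mean at the one-spin tower: `∫ σ d(U.tilted(a·σ)).tilted(s·σ + u·(e·σ)) = tanh (a + s + u·e)`. [folklore] -/
theorem toyTower_chordMean (a s e u : ℝ) :
    ∫ b, (if b then (1 : ℝ) else -1) ∂((((2 : ℝ≥0∞)⁻¹ • (Measure.count : Measure Bool)).tilted fun b => a * (if b then (1 : ℝ) else -1)).tilted
      fun b => s * (if b then (1 : ℝ) else -1) + u * (e * (if b then (1 : ℝ) else -1))) = Real.tanh (a + s + u * e) := by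
  rw [tilted_spin_add]
  have eq : (fun b : Bool => a * (if b then (1 : ℝ) else -1) + (s * (if b then (1 : ℝ) else -1) + u * (e * (if b then (1 : ℝ) else -1)))) =
      fun b => (a + s + u * e) * (if b then (1 : ℝ) else -1) := by funext b; ring
  rw [eq, integral_spin_tilted]

/-- The endpoint means: `r₀ = tanh (a + s)` (source tilt only) and `r₁ = tanh (a + s + e)` (after the defect). [folklore] -/
theorem toyTower_endpoints (a s e : ℝ) :
    (∫ b, (if b then (1 : ℝ) else -1) ∂((((2 : ℝ≥0∞)⁻¹ • (Measure.count : Measure Bool)).tilted fun b => a * (if b then (1 : ℝ) else -1)).tilted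
        fun b => s * (if b then (1 : ℝ) else -1)) = Real.tanh (a + s)) ∧
    (∫ b, (if b then (1 : ℝ) else -1) ∂((((2 : ℝ≥0∞)⁻¹ • (Measure.count : Measure Bool)).tilted fun b => a * (if b then (1 : ℝ) else -1)).tilted
        fun b => s * (if b then (1 : ℝ) else -1) + e * (if b then (1 : ℝ) else -1)) = Real.tanh (a + s + e)) := by
  constructor
  · have h := toyTower_chordMean a s e 0
    simp only [zero_mul, add_zero] at h
    exact h
  · have h := toyTower_chordMean a s e 1
    simp only [one_mul] at h
    exact h

/-- **DETUNING** along the straight chord: `|tanh(a+s+u·e) − ((1−u)·tanh(a+s) + u·tanh(a+s+e))| ≤ 2e` for `u ∈ [0,1]`, `e ≥ 0` (tanh is 1-Lipschitz, twice). [folklore] -/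
theorem toyTower_detuning {a s e u : ℝ} (he0 : 0 ≤ e) (hu : u ∈ Icc (0 : ℝ) 1) :
    |Real.tanh (a + s + u * e) - ((1 - u) * Real.tanh (a + s) + u * Real.tanh (a + s + e))| ≤ 2 * e := by
  have h1 : |Real.tanh (a + s + u * e) - Real.tanh (a + s)| ≤ u * e := by
    have := abs_tanh_sub_tanh_le (a + s + u * e) (a + s)
    rwa [show a + s + u * e - (a + s) = u * e by ring, abs_of_nonneg (mul_nonneg hu.1 he0)] at this
  have h2 : |Real.tanh (a + s + e) - Real.tanh (a + s)| ≤ e := by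
    have := abs_tanh_sub_tanh_le (a + s + e) (a + s)
    rwa [show a + s + e - (a + s) = e by ring, abs_of_nonneg he0] at this
  have e1 : Real.tanh (a + s + u * e) - ((1 - u) * Real.tanh (a + s) + u * Real.tanh (a + s + e)) =
      (Real.tanh (a + s + u * e) - Real.tanh (a + s)) - u * (Real.tanh (a + s + e) - Real.tanh (a + s)) := by ring
  rw [e1]
  calc |Real.tanh (a + s + u * e) - Real.tanh (a + s) - u * (Real.tanh (a + s + e) - Real.tanh (a + s))|
      ≤ |Real.tanh (a + s + u * e) - Real.tanh (a + s)| + |u * (Real.tanh (a + s + e) - Real.tanh (a + s))| := abs_sub _ _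
    _ ≤ u * e + u * e := by
        rw [abs_mul, abs_of_nonneg hu.1]
        exact add_le_add h1 (mul_le_mul_of_nonneg_left h2 hu.1)
    _ ≤ 2 * e := by nlinarith [hu.2]

/-- **THE CONDITIONED-OSCILLATION BUDGET (one class)**: with the trivial unit-field σ-algebra (`m = ⊤`, `ν̂[g|m] = g`) and `g = e·σ + w·σ`, the L¹-oscillation of the
conditioned countertermed defect is `≤ 2·(e + |w|)` under ANY probability law on the spin. [folklore] -/
theorem toyTower_osc (ν : Measure Bool) [IsProbabilityMeasure ν] (e w : ℝ) (he0 : 0 ≤ e) :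
    ∫ b, |(ν[fun b => e * (if b then (1 : ℝ) else -1) + w * (if b then (1 : ℝ) else -1)|(inferInstance : MeasurableSpace Bool)]) b -
        ∫ b', (e * (if b' then (1 : ℝ) else -1) + w * (if b' then (1 : ℝ) else -1)) ∂ν| ∂ν ≤ 2 * (e + |w|) := by
  set g : Bool → ℝ := fun b => e * (if b then (1 : ℝ) else -1) + w * (if b then (1 : ℝ) else -1) with hg
  haveI : SigmaFinite (ν.trim (le_refl (inferInstance : MeasurableSpace Bool))) := by rw [trim_eq_self]; infer_instance
  have hgm : StronglyMeasurable g := (measurable_of_countable g).stronglyMeasurable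
  have hgi : Integrable g ν := Integrable.of_finite
  rw [condExp_of_stronglyMeasurable (le_refl _) hgm hgi]
  have hgb : ∀ b, |g b| ≤ e + |w| := fun b => by
    rw [hg]; cases b <;> simp <;>
      [ (calc |-e + -w| = |e + w| := by rw [← abs_neg]; ring_nf
          _ ≤ |e| + |w| := abs_add_le _ _
          _ = e + |w| := by rw [abs_of_nonneg he0]);
        (calc |e + w| ≤ |e| + |w| := abs_add_le _ _
          _ = e + |w| := by rw [abs_of_nonneg he0]) ]
  have hmean : |∫ b', g b' ∂ν| ≤ e + |w| := by
    calc |∫ b', g b' ∂ν| ≤ ∫ b', |g b'| ∂ν := abs_integral_le_integral_abs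
      _ ≤ ∫ b', (e + |w|) ∂ν := integral_mono_of_nonneg (Eventually.of_forall fun _ => abs_nonneg _) (integrable_const _)
          (Eventually.of_forall hgb)
      _ = e + |w| := by rw [integral_const, smul_eq_mul, probReal_univ, one_mul]
  calc ∫ b, |g b - ∫ b', g b' ∂ν| ∂ν ≤ ∫ b, 2 * (e + |w|) ∂ν :=
        integral_mono_of_nonneg (Eventually.of_forall fun _ => abs_nonneg _) (integrable_const _)
          (Eventually.of_forall fun b => (abs_sub _ _).trans (by linarith [hgb b, hmean]))
    _ = 2 * (e + |w|) := by rw [integral_const, smul_eq_mul, probReal_univ, one_mul]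

end Data

/-! ## §4 The package applied: Cauchy generating functions on a tower with non-trivial summable defects -/
section Tower

/-- **THE PACKAGE APPLIED AT LETTERS** [decided up to the letters]: accumulated tilts `|a_K| ≤ c₀ ≤ 1∕100`, defect sizes `0 ≤ c_K ≤ c₀∕2` with `a_{K+1} = a_K + c_K`
and `Σ c_K < ∞` ⇒ on the one-spin tower `μ_K = U.tilted(a_K·σ)`, `D_K = c_K·σ`, `π = id`, `F = R = S = σ`, `m = ⊤`, `l₀ = V = ½`, `vol = B₀ = 1`, `γ = (cosh 5∕4)⁻²`,
`b_K = 2·(c_K + 3c_K∕γ)`, EVERY binder of `cauchySeq_genFun_of_tunedData` is supplied: `K ↦ genFun Z K t` (`Z K t = mgf σ μ_K t`) is Cauchy for `|t| ≤ ½`.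
[folklore ∘ `cauchySeq_genFun_of_tunedData`] -/
theorem tunedTower_cauchy_of_letters {a c : ℕ → ℝ} {c₀ : ℝ} (hc₀ : c₀ ≤ 1 / 100) (hc0 : ∀ K, 0 ≤ c K) (hcle : ∀ K, c K ≤ c₀ / 2)
    (haK : ∀ K, |a K| ≤ c₀) (hacc : ∀ K, a (K + 1) = a K + c K) (hcs : Summable c) {t : ℝ} (ht : |t| ≤ 1 / 2) :
    CauchySeq fun K => genFun (fun K t => mgf (fun b : Bool => if b then (1 : ℝ) else -1)
      (((2 : ℝ≥0∞)⁻¹ • (Measure.count : Measure Bool)).tilted fun b => a K * (if b then (1 : ℝ) else -1)) t) K t := by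
  have hγ₀pos : 0 < (Real.cosh (5 / 4) ^ 2)⁻¹ := by positivity
  have hσm : Measurable fun b : Bool => if b then (1 : ℝ) else -1 := measurable_of_countable _
  have hσb : ∀ b : Bool, |(if b then (1 : ℝ) else -1)| ≤ 1 := fun b => by cases b <;> simp
  have hμ : ∀ K, IsProbabilityMeasure (((2 : ℝ≥0∞)⁻¹ • (Measure.count : Measure Bool)).tilted fun b => a K * (if b then (1 : ℝ) else -1)) :=
    fun K => isProbabilityMeasure_spinLaw (a K)
  refine cauchySeq_genFun_of_tunedData (Ω := fun _ => Bool) (m := fun _ => inferInstance)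
    (μ := fun K => ((2 : ℝ≥0∞)⁻¹ • (Measure.count : Measure Bool)).tilted fun b => a K * (if b then (1 : ℝ) else -1))
    (π := fun _ => id) (F := fun _ b => if b then (1 : ℝ) else -1) (D := fun K b => c K * (if b then (1 : ℝ) else -1))
    (S := fun _ b => if b then (1 : ℝ) else -1) (R := fun _ b => if b then (1 : ℝ) else -1) (B₀ := 1) (vol := 1) (l₀ := 1 / 2)
    (CD := c) (CS := fun _ => 1) (CR := fun _ => 1) (γ := fun _ => (Real.cosh (5 / 4) ^ 2)⁻¹) (V := fun _ => 1 / 2)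
    (b := fun K => 2 * (c K + 3 * c K / (Real.cosh (5 / 4) ^ 2)⁻¹))
    (Z := fun K t => mgf (fun b : Bool => if b then (1 : ℝ) else -1)
      (((2 : ℝ≥0∞)⁻¹ • (Measure.count : Measure Bool)).tilted fun b => a K * (if b then (1 : ℝ) else -1)) t)
    one_pos (by norm_num) hμ (fun _ => measurable_id) (fun _ => le_rfl) (fun _ => hσm.stronglyMeasurable) (fun _ => hσb) (fun _ _ => rfl)
    (fun K => measurable_of_countable _) (fun K b => ?_) (fun K => map_id_spinLaw_succ (hacc K)) (fun _ => hσm) (fun _ => hσb) (fun _ => hσm)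
    (fun _ => hσb) (fun _ => hγ₀pos) (fun _ => by norm_num) (fun K s hs u hu v hv => ?_) (fun K s hs u hu => ?_)
    (fun K s hs u hu v hv w hw => ?_) ?_ (fun K t => rfl) ht
  · -- |D_K| ≤ c_K
    rw [abs_mul, abs_of_nonneg (hc0 K)]
    exact mul_le_of_le_one_right (hc0 K) (hσb b)
  · -- response
    exact toyTower_response hc₀ (haK K) hs (hc0 K) ((hcle K).trans (by linarith [(abs_nonneg _).trans (haK 0)])) hu hv
  · -- detuning ≤ 2 c_K ≤ γ₀ · V
    rw [toyTower_chordMean, (toyTower_endpoints (a K) s (c K)).1, (toyTower_endpoints (a K) s (c K)).2]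
    refine (toyTower_detuning (hc0 K) hu).trans ?_
    have hw := gamma0_window
    nlinarith [hcle K]
  · -- the conditioned-oscillation budget
    haveI := hμ K
    haveI : IsProbabilityMeasure ((((2 : ℝ≥0∞)⁻¹ • (Measure.count : Measure Bool)).tilted fun b => a K * (if b then (1 : ℝ) else -1)).tilted
        fun x => s * (if x then (1 : ℝ) else -1) + u * (c K * (if x then (1 : ℝ) else -1)) + v * (if x then (1 : ℝ) else -1)) :=
      isProbabilityMeasure_tilted Integrable.of_finite
    refine (toyTower_osc _ (c K) w (hc0 K)).trans ?_
    -- |w| ≤ (|r₁ − r₀| + 2·c_K)/γ₀ ≤ 3 c_K/γ₀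
    rw [(toyTower_endpoints (a K) s (c K)).1, (toyTower_endpoints (a K) s (c K)).2] at hw
    have hgap : |Real.tanh (a K + s + c K) - Real.tanh (a K + s)| ≤ c K := by
      have := abs_tanh_sub_tanh_le (a K + s + c K) (a K + s)
      rwa [show a K + s + c K - (a K + s) = c K by ring, abs_of_nonneg (hc0 K)] at this
    have hw' : |w| ≤ 3 * c K / (Real.cosh (5 / 4) ^ 2)⁻¹ := by
      refine hw.trans (div_le_div_of_nonneg_right ?_ hγ₀pos.le)
      linarith
    have : |w| * (Real.cosh (5 / 4) ^ 2)⁻¹ ≤ 3 * c K := by rwa [le_div_iff₀ hγ₀pos] at hw'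
    nlinarith
  · -- summability of the budget
    have e : (fun K => 2 * (c K + 3 * c K / (Real.cosh (5 / 4) ^ 2)⁻¹)) = fun K => (2 + 6 / (Real.cosh (5 / 4) ^ 2)⁻¹) * c K := by
      funext K; ring
    rw [e]
    exact hcs.mul_left _

/-- ★★ **`cauchySeq_genFun_of_tunedData` INHABITED WITH NON-TRIVIAL DEFECTS** [decided]: for `0 < c₀ ≤ 1∕100` and `|t| ≤ ½`, on the one-spin tower with accumulated tilts
`a_K = (c₀∕2)Σ_{j<K}2^{−j}` and defects `D_K = (c₀∕2)2^{−K}·σ` (so `μ_{K+1} = μ_K.tilted D_K`), `K ↦ genFun Z K t` (`Z K t = mgf σ μ_K t`) is Cauchy — every binder of the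
package supplied by §§1–3 (`tunedTower_cauchy_of_letters`). [folklore] -/
theorem toy_tunedTower_cauchy {c₀ : ℝ} (hc₀ : 0 < c₀) (hc₀' : c₀ ≤ 1 / 100) {t : ℝ} (ht : |t| ≤ 1 / 2) :
    CauchySeq fun K => genFun (fun K t => mgf (fun b : Bool => if b then (1 : ℝ) else -1)
      (((2 : ℝ≥0∞)⁻¹ • (Measure.count : Measure Bool)).tilted fun b => (c₀ / 2 * ∑ j ∈ range K, (1 / 2 : ℝ) ^ j) * (if b then (1 : ℝ) else -1)) t) K t := by
  refine tunedTower_cauchy_of_letters (a := fun K => c₀ / 2 * ∑ j ∈ range K, (1 / 2 : ℝ) ^ j) (c := fun K => c₀ / 2 * (1 / 2 : ℝ) ^ K) hc₀'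
    (fun K => by positivity) (fun K => ?_) (fun K => ?_) (fun K => accum_succ c₀ K) ((summable_geometric_two).mul_left (c₀ / 2)) ht
  · have : (1 / 2 : ℝ) ^ K ≤ 1 := pow_le_one₀ (by norm_num) (by norm_num)
    nlinarith
  · rw [abs_of_nonneg (accum_nonneg hc₀.le K)]; exact accum_le hc₀.le K

/-- ★ **NON-DEGENERACY** [decided]: at every cutoff the defect is a non-zero function and MOVES the renormalisation observable
(`r₁(K) = tanh(a_K + s + c_K) ≠ tanh(a_K + s) = r₀(K)`, tanh injective). -/
theorem toy_tunedTower_nondegenerate {c₀ : ℝ} (hc₀ : 0 < c₀) (K : ℕ) (s : ℝ) :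
    (fun b : Bool => c₀ / 2 * (1 / 2 : ℝ) ^ K * (if b then (1 : ℝ) else -1)) ≠ 0 ∧
    Real.tanh (c₀ / 2 * (∑ j ∈ range K, (1 / 2 : ℝ) ^ j) + s + c₀ / 2 * (1 / 2 : ℝ) ^ K) ≠
      Real.tanh (c₀ / 2 * (∑ j ∈ range K, (1 / 2 : ℝ) ^ j) + s) := by
  have hcK : 0 < c₀ / 2 * (1 / 2 : ℝ) ^ K := by positivity
  refine ⟨fun h => ?_, fun h => ?_⟩
  · have := congr_fun h true
    simp only [if_true, mul_one, Pi.zero_apply] at this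
    exact hcK.ne' this
  · have hinj := Real.tanh_injective h
    linarith

end Tower

end YMDAG.N14.LawChannelTunedEndToEndToy

end
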